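import Summits.AtomisticToContinuum.HydrodynamicLimit.Theorems.JParityClosureLocalSecondLawLedgerDefs
import Summits.AtomisticToContinuum.HydrodynamicLimit.Theorems.LocalSecondLaw.Negative.LinearMajorant
import Summits.AtomisticToContinuum.HydrodynamicLimit.Theorems.DensityCap.Negative.MollifiedDensity
import Literature.MathematicalPhysics.KineticTheory.HardSphereEulerProofs

/-!
# Kinetic-stress algebra for the entropy-ledger line of `JParityClosure.LocalSecondLaw`
(stmt-AtomisticToContinuum-13081, line `exact-entropy-ledger-three-passivities`; support of the stubs
`stub_passivityKinetic` (P1) and `stub_ledger` (L); file 1 of 3 of the kinetic-stress regularity package,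
continued in `…KineticStressStrain.lean` and `…KineticStressRegularity.lean`)

Closed ALGEBRAIC lemmas about the traceless peculiar stress `Σ^dev_r = devC` of the ledger vocabulary
(`Theorems/JParityClosureLocalSecondLawLedgerDefs.lean`: `uC`, `devC`): particle-sum forms of `ρ_r, m_r, e_r, u_r,
Σ^dev_r`; **exact tracelessness** of `Σ^dev_r` for `0 < r` (`devC_trace`:
`∑ₖ Σ^dev_{kk} = (N+1)⁻¹∑ᵢ bᵢ|vᵢ − u_r|² − 3ρ_rθ_r = (2e_r − |m_r|²/ρ_r) − (2e_r − |m_r|²/ρ_r) = 0` by the very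
definition of `θ_r`, the junk branch `ρ_r = 0` included since then every cone weight vanishes) — this is the check
behind the NSF sanity value `T₁ ≈ ∫∫ 2μ|S°|²φ/θ ≥ 0` of the kinetic-anisotropy work; and its consequences
`0 ≤ ρ_rθ_r`, `(N+1)⁻¹∑ᵢ bᵢ(v_{ik} − u_k)² ≤ 3ρ_rθ_r`, `ρ_rθ_r ≤ (2/3)e_r`, `e_r ≤ 3 ke/(πr³)` and the bound
`|Σ^dev_{kl}| ≤ 4ρ_rθ_r ≤ 8 ke/(πr³)` (`abs_devC_le_rhoC_mul_thetaC`, `psvK_abs_devC_le_ke`) that makes every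
`Σ^dev`-weighted statistic of the line bounded by the (conserved) mean kinetic energy.
All names carry the prefix `psvK_` (passivity-kinetic support) except the registered sub-goals at the end.

References: J. H. Irving, J. G. Kirkwood, J. Chem. Phys. 18 (1950) 817 (microscopic stress tensor);
H. Spohn, *Large Scale Dynamics of Interacting Particles* (1991), Part I §3 (setting).
-/

noncomputable section

namespace Summit.AtomisticToContinuum.HydrodynamicLimit.Theorems.LocalSecondLawLedger

open scoped BigOperators Topology Classical MeasureTheory ENNReal InnerProductSpace
open Filter Set MeasureTheory
open Literature.MathematicalPhysics.KineticTheory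
open Literature.Analysis.FluidPDE
open Summit.AtomisticToContinuum.HydrodynamicLimit.Theorems.LocalSecondLawNegative

variable {N : ℕ}

/-! ## Finite-sum forms of the coarse fields -/

/-- `ρ_r` as a particle sum. -/
theorem psvK_rhoC_eq_sum (r : ℝ) (w : Phase N) (x₀ : T3) :
    rhoC r w x₀ = ((N + 1 : ℕ) : ℝ)⁻¹ * ∑ i, cone r (w i).1 x₀ := by
  unfold rhoC; rw [integral_empiricalMeasure]

/-- `m_r` as a particle sum. -/
theorem psvK_momC_eq_sum (r : ℝ) (w : Phase N) (x₀ : T3) :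
    momC r w x₀ = ((N + 1 : ℕ) : ℝ)⁻¹ • ∑ i, cone r (w i).1 x₀ • (w i).2 := by
  show empiricalMomentumField w (fun y => cone r y x₀) = _
  rw [empiricalMomentumField_eq_sum]

/-- A coordinate of `m_r` as a particle sum. -/
theorem psvK_momC_apply_eq_sum (r : ℝ) (w : Phase N) (x₀ : T3) (l : Fin 3) :
    momC r w x₀ l = ((N + 1 : ℕ) : ℝ)⁻¹ * ∑ i, cone r (w i).1 x₀ * (w i).2 l := by
  rw [psvK_momC_eq_sum]
  simp only [PiLp.smul_apply, WithLp.ofLp_sum, Finset.sum_apply, smul_eq_mul]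

/-- `Σ^dev_r` as a particle sum. -/
theorem psvK_devC_eq_sum (r : ℝ) (w : Phase N) (x₀ : T3) (k l : Fin 3) :
    devC r w x₀ k l = ((N + 1 : ℕ) : ℝ)⁻¹ *
        ∑ i, cone r (w i).1 x₀ * (((w i).2 k - uC r w x₀ k) * ((w i).2 l - uC r w x₀ l)) -
      rhoC r w x₀ * thetaC r w x₀ * (if k = l then 1 else 0) := by
  unfold devC; rw [integral_empiricalMeasure]

/-- The diagonal entries of `Σ^dev_r` as particle sums. -/
theorem psvK_devC_diag_eq_sum (r : ℝ) (w : Phase N) (x₀ : T3) (k : Fin 3) :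
    devC r w x₀ k k = ((N + 1 : ℕ) : ℝ)⁻¹ *
        ∑ i, cone r (w i).1 x₀ * (((w i).2 k - uC r w x₀ k) * ((w i).2 k - uC r w x₀ k)) -
      rhoC r w x₀ * thetaC r w x₀ := by
  rw [psvK_devC_eq_sum, if_pos rfl, mul_one]

/-- A coordinate of the coarse velocity: `u_{r,l} = ρ_r⁻¹ m_{r,l}`. -/
theorem psvK_uC_apply (r : ℝ) (w : Phase N) (x₀ : T3) (l : Fin 3) :
    uC r w x₀ l = (rhoC r w x₀)⁻¹ * momC r w x₀ l := by
  unfold uC; rw [PiLp.smul_apply, smul_eq_mul]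

/-- `e_r` as a particle sum in coordinates: `e_r = (N+1)⁻¹ ∑ᵢ bᵢ (∑ₖ v_{ik}²)/2`. -/
theorem psvK_kinC_eq_sum_coord (r : ℝ) (w : Phase N) (x₀ : T3) :
    kinC r w x₀ = ((N + 1 : ℕ) : ℝ)⁻¹ * ∑ i, cone r (w i).1 x₀ * ((∑ k, (w i).2 k ^ 2) / 2) := by
  rw [kinC_eq_sum]
  congr 1
  refine Finset.sum_congr rfl fun i _ => ?_
  rw [EuclideanSpace.real_norm_sq_eq]

/-! ## (b) Exact tracelessness of `Σ^dev_r` -/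

/-- If `ρ_r(x₀) = 0` (and `0 < r`) then every cone weight at `x₀` vanishes. -/
theorem psvK_cone_eq_zero_of_rhoC_eq_zero {r : ℝ} (hr : 0 < r) {w : Phase N} {x₀ : T3}
    (h : rhoC r w x₀ = 0) (i : Fin (N + 1)) : cone r (w i).1 x₀ = 0 := by
  rw [psvK_rhoC_eq_sum] at h
  have hN : ((N + 1 : ℕ) : ℝ)⁻¹ ≠ 0 := by positivity
  have hsum : ∑ j, cone r (w j).1 x₀ = 0 := by
    rcases mul_eq_zero.1 h with h | h
    · exact absurd h hN
    · exact h
  exact (Finset.sum_eq_zero_iff_of_nonneg fun j _ => cone_nonneg hr (w j).1 x₀).1 hsum i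
    (Finset.mem_univ _)

/-- The algebra of the trace identity, over the per-coordinate sums `S0 = ∑ bᵢ`, `S1ₖ = ∑ bᵢ v_{ik}`,
`S2ₖ = ∑ bᵢ v_{ik}²` and the normalisation `n = (N+1)⁻¹`. -/
theorem psvK_trace_algebra (n S0 : ℝ) (S1 S2 : Fin 3 → ℝ) (hn : n ≠ 0) (hS0 : S0 ≠ 0) :
    ∑ k, n * (S2 k - 2 * ((n * S0)⁻¹ * (n * S1 k)) * S1 k + ((n * S0)⁻¹ * (n * S1 k)) ^ 2 * S0) -
      3 * (n * S0 * (2 / 3 * (n * ((∑ k, S2 k) / 2) / (n * S0) -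
        (∑ k, (n * S1 k) ^ 2) / (2 * (n * S0) ^ 2)))) = 0 := by
  have h1 : ∑ k, n * (S2 k - 2 * ((n * S0)⁻¹ * (n * S1 k)) * S1 k +
      ((n * S0)⁻¹ * (n * S1 k)) ^ 2 * S0) = n * ∑ k, S2 k - n * (∑ k, S1 k ^ 2) / S0 := by
    rw [Finset.mul_sum, Finset.mul_sum, Finset.sum_div, ← Finset.sum_sub_distrib]
    refine Finset.sum_congr rfl fun k _ => ?_
    field_simp
    ring
  have h2 : ∑ k, (n * S1 k) ^ 2 = n ^ 2 * ∑ k, S1 k ^ 2 := by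
    rw [Finset.mul_sum]; exact Finset.sum_congr rfl fun k _ => by ring
  rw [h1, h2]
  field_simp
  ring

/-- **`Σ^dev_r` is exactly traceless** (`0 < r`): `∑ₖ Σ^dev_{kk} = (N+1)⁻¹∑ᵢ bᵢ|vᵢ − u_r|² − 3ρ_rθ_r
= (2e_r − |m_r|²/ρ_r) − (2e_r − |m_r|²/ρ_r) = 0` by the definition of `θ_r`; in the junk branch
`ρ_r = 0` all cone weights vanish and both sides are `0`. -/
theorem psvK_devC_trace {r : ℝ} (hr : 0 < r) (w : Phase N) (x₀ : T3) :
    ∑ k, devC r w x₀ k k = 0 := by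
  set n : ℝ := ((N + 1 : ℕ) : ℝ)⁻¹ with hn
  set c : Fin (N + 1) → ℝ := fun i => cone r (w i).1 x₀ with hc
  set v : Fin (N + 1) → Fin 3 → ℝ := fun i k => (w i).2 k with hv
  have hρ : rhoC r w x₀ = n * ∑ i, c i := psvK_rhoC_eq_sum r w x₀
  have hm : ∀ l, momC r w x₀ l = n * ∑ i, c i * v i l := fun l => psvK_momC_apply_eq_sum r w x₀ l
  have he : kinC r w x₀ = n * ∑ i, c i * ((∑ k, v i k ^ 2) / 2) := psvK_kinC_eq_sum_coord r w x₀
  have hu : ∀ l, uC r w x₀ l = (rhoC r w x₀)⁻¹ * momC r w x₀ l := fun l => psvK_uC_apply r w x₀ l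
  have hdev : ∀ k, devC r w x₀ k k =
      n * ∑ i, c i * ((v i k - uC r w x₀ k) * (v i k - uC r w x₀ k)) -
        rhoC r w x₀ * thetaC r w x₀ := fun k => psvK_devC_diag_eq_sum r w x₀ k
  simp only [hdev, Finset.sum_sub_distrib, Finset.sum_const, Finset.card_univ, Fintype.card_fin,
    nsmul_eq_mul, Nat.cast_ofNat]
  by_cases hρ0 : rhoC r w x₀ = 0
  · -- junk branch: all weights vanish
    have hci : ∀ i, c i = 0 := fun i => psvK_cone_eq_zero_of_rhoC_eq_zero hr hρ0 i
    simp [hci, hρ0]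
  · -- honest branch: algebra
    have hθ : thetaC r w x₀ = 2 / 3 * (kinC r w x₀ / rhoC r w x₀ -
        (∑ k, momC r w x₀ k ^ 2) / (2 * rhoC r w x₀ ^ 2)) := by
      unfold thetaC; rw [EuclideanSpace.real_norm_sq_eq]
    have hexp : ∀ k, ∑ i, c i * ((v i k - uC r w x₀ k) * (v i k - uC r w x₀ k)) =
        (∑ i, c i * v i k ^ 2) - 2 * uC r w x₀ k * (∑ i, c i * v i k) +
          uC r w x₀ k ^ 2 * ∑ i, c i := by
      intro k
      rw [Finset.mul_sum, Finset.mul_sum, ← Finset.sum_sub_distrib, ← Finset.sum_add_distrib]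
      exact Finset.sum_congr rfl fun i _ => by ring
    have he' : kinC r w x₀ = n * ((∑ k, ∑ i, c i * v i k ^ 2) / 2) := by
      rw [he]
      congr 1
      have hin : ∀ i, c i * ((∑ k, v i k ^ 2) / 2) = ∑ k, c i * v i k ^ 2 / 2 := fun i => by
        rw [Finset.sum_div, Finset.mul_sum]
        exact Finset.sum_congr rfl fun k _ => by ring
      simp only [hin]
      rw [Finset.sum_comm, Finset.sum_div]
      exact Finset.sum_congr rfl fun k _ => by rw [Finset.sum_div]
    have hS0ne : (∑ i, c i) ≠ 0 := by
      intro h0; apply hρ0; rw [hρ, h0, mul_zero]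
    have hnne : n ≠ 0 := by rw [hn]; positivity
    have hu' : ∀ l, uC r w x₀ l = (n * ∑ i, c i)⁻¹ * (n * ∑ i, c i * v i l) := fun l => by
      rw [hu l, hm l, hρ]
    simp only [hexp]
    simp only [hu', hθ, hm, he', hρ]
    exact psvK_trace_algebra n (∑ i, c i) (fun k => ∑ i, c i * v i k) (fun k => ∑ i, c i * v i k ^ 2)
      hnne hS0ne

/-- The trace identity read as `∑ₖ (N+1)⁻¹∑ᵢ bᵢ (v_{ik} − u_k)² = 3 ρ_r θ_r` (`0 < r`). -/
theorem psvK_sum_peculiar_sq_eq {r : ℝ} (hr : 0 < r) (w : Phase N) (x₀ : T3) :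
    ∑ k, ((N + 1 : ℕ) : ℝ)⁻¹ * ∑ i, cone r (w i).1 x₀ * ((w i).2 k - uC r w x₀ k) ^ 2 =
      3 * (rhoC r w x₀ * thetaC r w x₀) := by
  have h := psvK_devC_trace hr w x₀
  simp only [psvK_devC_diag_eq_sum, Finset.sum_sub_distrib, Finset.sum_const, Finset.card_univ,
    Fintype.card_fin, nsmul_eq_mul, Nat.cast_ofNat] at h
  have hsq : ∀ k, (∑ i, cone r (w i).1 x₀ * ((w i).2 k - uC r w x₀ k) ^ 2) =
      ∑ i, cone r (w i).1 x₀ * (((w i).2 k - uC r w x₀ k) * ((w i).2 k - uC r w x₀ k)) :=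
    fun k => Finset.sum_congr rfl fun i _ => by ring
  simp only [hsq]
  linarith

/-! ## Elementary bounds -/

/-- `e_r ≤ 3/(πr³) · ke` (`0 < r`; the kernel peak bound is the tree's `DensityCapNegative.cone_le`, same kernel
definitionally). -/
theorem psvK_kinC_le {r : ℝ} (hr : 0 < r) (w : Phase N) (x₀ : T3) :
    kinC r w x₀ ≤ 3 / (Real.pi * r ^ 3) * ke w := by
  rw [kinC_eq_sum]
  unfold ke
  calc ((N + 1 : ℕ) : ℝ)⁻¹ * ∑ i, cone r (w i).1 x₀ * (‖(w i).2‖ ^ 2 / 2)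
      ≤ ((N + 1 : ℕ) : ℝ)⁻¹ * ∑ i, 3 / (Real.pi * r ^ 3) * (‖(w i).2‖ ^ 2 / 2) := by
        gcongr with i
        exact DensityCapNegative.cone_le hr _ _
    _ = 3 / (Real.pi * r ^ 3) * (((N + 1 : ℕ) : ℝ)⁻¹ * ∑ i, ‖(w i).2‖ ^ 2 / 2) := by
        rw [← Finset.mul_sum]; ring

/-- On `{ρ_r ≠ 0}`: `ρ_r θ_r = (2/3)(e_r − |m_r|²/(2ρ_r))`. -/
theorem psvK_rhoC_mul_thetaC {r : ℝ} {w : Phase N} {x₀ : T3} (h : rhoC r w x₀ ≠ 0) :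
    rhoC r w x₀ * thetaC r w x₀ = 2 / 3 * (kinC r w x₀ - ‖momC r w x₀‖ ^ 2 / (2 * rhoC r w x₀)) := by
  unfold thetaC
  field_simp

/-- `ρ_r θ_r ≤ (2/3) e_r` (`0 < r`). -/
theorem psvK_rhoC_mul_thetaC_le {r : ℝ} (hr : 0 < r) (w : Phase N) (x₀ : T3) :
    rhoC r w x₀ * thetaC r w x₀ ≤ 2 / 3 * kinC r w x₀ := by
  by_cases h : rhoC r w x₀ = 0
  · rw [h, zero_mul]; exact mul_nonneg (by norm_num) (kinC_nonneg hr w x₀)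
  · rw [psvK_rhoC_mul_thetaC h]
    have hρ : 0 < rhoC r w x₀ := lt_of_le_of_ne (rhoC_nonneg hr w x₀) (Ne.symm h)
    have : 0 ≤ ‖momC r w x₀‖ ^ 2 / (2 * rhoC r w x₀) := by positivity
    linarith

/-- `0 ≤ ρ_r θ_r` (`0 < r`): a third of a sum of non-negative peculiar second moments. -/
theorem psvK_rhoC_mul_thetaC_nonneg {r : ℝ} (hr : 0 < r) (w : Phase N) (x₀ : T3) :
    0 ≤ rhoC r w x₀ * thetaC r w x₀ := by
  have h := psvK_sum_peculiar_sq_eq hr w x₀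
  have hnn : 0 ≤ ∑ k, ((N + 1 : ℕ) : ℝ)⁻¹ *
      ∑ i, cone r (w i).1 x₀ * ((w i).2 k - uC r w x₀ k) ^ 2 :=
    Finset.sum_nonneg fun k _ => mul_nonneg (by positivity)
      (Finset.sum_nonneg fun i _ => mul_nonneg (cone_nonneg hr _ _) (sq_nonneg _))
  linarith

/-- On the floors `0 < ρ_r`, the coarse temperature is at most `(2/3) e_r / ρ_r ≤ 2 ke /(π r³ ρ_r)`. -/
theorem psvK_thetaC_le {r : ℝ} (hr : 0 < r) (w : Phase N) (x₀ : T3) (hρ : 0 < rhoC r w x₀) :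
    thetaC r w x₀ ≤ 2 / 3 * kinC r w x₀ / rhoC r w x₀ := by
  rw [le_div_iff₀ hρ, mul_comm]
  exact psvK_rhoC_mul_thetaC_le hr w x₀

/-- Each peculiar second moment is at most `3ρ_rθ_r` (`0 < r`). -/
theorem psvK_peculiar_sq_le {r : ℝ} (hr : 0 < r) (w : Phase N) (x₀ : T3) (k : Fin 3) :
    ((N + 1 : ℕ) : ℝ)⁻¹ * ∑ i, cone r (w i).1 x₀ * ((w i).2 k - uC r w x₀ k) ^ 2 ≤
      3 * (rhoC r w x₀ * thetaC r w x₀) := by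
  rw [← psvK_sum_peculiar_sq_eq hr w x₀]
  exact Finset.single_le_sum (f := fun k => ((N + 1 : ℕ) : ℝ)⁻¹ *
      ∑ i, cone r (w i).1 x₀ * ((w i).2 k - uC r w x₀ k) ^ 2)
    (fun k _ => mul_nonneg (by positivity)
      (Finset.sum_nonneg fun i _ => mul_nonneg (cone_nonneg hr _ _) (sq_nonneg _)))
    (Finset.mem_univ k)

/-- Weighted Cauchy–Schwarz in the crude form `|∑ cᵢ aᵢ bᵢ| ≤ (∑ cᵢ aᵢ² + ∑ cᵢ bᵢ²)/2` (`cᵢ ≥ 0`). -/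
theorem psvK_abs_sum_mul_le {m : ℕ} (c a b : Fin m → ℝ) (hc : ∀ i, 0 ≤ c i) :
    |∑ i, c i * (a i * b i)| ≤ ((∑ i, c i * a i ^ 2) + ∑ i, c i * b i ^ 2) / 2 := by
  rw [← Finset.sum_add_distrib, Finset.sum_div]
  refine (Finset.abs_sum_le_sum_abs _ _).trans (Finset.sum_le_sum fun i _ => ?_)
  rw [abs_mul, abs_of_nonneg (hc i), abs_mul]
  have h := hc i
  nlinarith [sq_nonneg (|a i| - |b i|), sq_abs (a i), sq_abs (b i), abs_nonneg (a i),
    abs_nonneg (b i)]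

/-- **Bound of the traceless stress by the thermal energy density**: `|Σ^dev_{kl}| ≤ 4 ρ_r θ_r`
(`0 < r`; both off-diagonal and diagonal entries). -/
theorem psvK_abs_devC_le {r : ℝ} (hr : 0 < r) (w : Phase N) (x₀ : T3) (k l : Fin 3) :
    |devC r w x₀ k l| ≤ 4 * (rhoC r w x₀ * thetaC r w x₀) := by
  rw [psvK_devC_eq_sum]
  have hn : (0 : ℝ) ≤ ((N + 1 : ℕ) : ℝ)⁻¹ := by positivity
  have hPk := psvK_peculiar_sq_le hr w x₀ k
  have hPl := psvK_peculiar_sq_le hr w x₀ l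
  have hρθ := psvK_rhoC_mul_thetaC_nonneg hr w x₀
  have h1 : |((N + 1 : ℕ) : ℝ)⁻¹ *
      ∑ i, cone r (w i).1 x₀ * (((w i).2 k - uC r w x₀ k) * ((w i).2 l - uC r w x₀ l))| ≤
      3 * (rhoC r w x₀ * thetaC r w x₀) := by
    rw [abs_mul, abs_of_nonneg hn]
    have h := psvK_abs_sum_mul_le (fun i => cone r (w i).1 x₀) (fun i => (w i).2 k - uC r w x₀ k)
      (fun i => (w i).2 l - uC r w x₀ l) (fun i => cone_nonneg hr _ _)
    calc ((N + 1 : ℕ) : ℝ)⁻¹ *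
          |∑ i, cone r (w i).1 x₀ * (((w i).2 k - uC r w x₀ k) * ((w i).2 l - uC r w x₀ l))|
        ≤ ((N + 1 : ℕ) : ℝ)⁻¹ * (((∑ i, cone r (w i).1 x₀ * ((w i).2 k - uC r w x₀ k) ^ 2) +
            ∑ i, cone r (w i).1 x₀ * ((w i).2 l - uC r w x₀ l) ^ 2) / 2) :=
          mul_le_mul_of_nonneg_left h hn
      _ = (((N + 1 : ℕ) : ℝ)⁻¹ * (∑ i, cone r (w i).1 x₀ * ((w i).2 k - uC r w x₀ k) ^ 2) +
            ((N + 1 : ℕ) : ℝ)⁻¹ * ∑ i, cone r (w i).1 x₀ * ((w i).2 l - uC r w x₀ l) ^ 2) / 2 := by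
          ring
      _ ≤ (3 * (rhoC r w x₀ * thetaC r w x₀) + 3 * (rhoC r w x₀ * thetaC r w x₀)) / 2 := by
          gcongr
      _ = 3 * (rhoC r w x₀ * thetaC r w x₀) := by ring
  have h2 : |rhoC r w x₀ * thetaC r w x₀ * (if k = l then 1 else 0)| ≤
      rhoC r w x₀ * thetaC r w x₀ := by
    split_ifs
    · rw [mul_one, abs_of_nonneg hρθ]
    · rw [mul_zero, abs_zero]; exact hρθ
  calc _ ≤ |((N + 1 : ℕ) : ℝ)⁻¹ *
          ∑ i, cone r (w i).1 x₀ * (((w i).2 k - uC r w x₀ k) * ((w i).2 l - uC r w x₀ l))| +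
        |rhoC r w x₀ * thetaC r w x₀ * (if k = l then 1 else 0)| := abs_sub _ _
    _ ≤ 3 * (rhoC r w x₀ * thetaC r w x₀) + rhoC r w x₀ * thetaC r w x₀ := add_le_add h1 h2
    _ = 4 * (rhoC r w x₀ * thetaC r w x₀) := by ring

/-- `|Σ^dev_{kl}| ≤ 8 ke/(π r³)` (`0 < r`): the stress is controlled by the mean kinetic energy. -/
theorem psvK_abs_devC_le_ke {r : ℝ} (hr : 0 < r) (w : Phase N) (x₀ : T3) (k l : Fin 3) :
    |devC r w x₀ k l| ≤ 8 / (Real.pi * r ^ 3) * ke w := by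
  have h1 := psvK_abs_devC_le hr w x₀ k l
  have h2 := psvK_rhoC_mul_thetaC_le hr w x₀
  have h3 := psvK_kinC_le hr w x₀
  have h4 : 0 ≤ 3 / (Real.pi * r ^ 3) * ke w := mul_nonneg (by positivity) (ke_nonneg w)
  calc |devC r w x₀ k l| ≤ 4 * (2 / 3 * (3 / (Real.pi * r ^ 3) * ke w)) := by nlinarith
    _ = 8 / (Real.pi * r ^ 3) * ke w := by ring



/-! ## Registered sub-goals (stmt-AtomisticToContinuum-13081; signatures verbatim) -/

/-- Registered sub-goal `devC_trace`: exact tracelessness of `Σ^dev_r` (`0 < r`). -/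
theorem devC_trace :
  ∀ {N : ℕ} {r : ℝ}, 0 < r → ∀ (w : Phase N) (x₀ : T3), ∑ k : Fin 3, devC r w x₀ k k = 0 :=
  fun hr w x₀ => psvK_devC_trace hr w x₀

/-- Registered sub-goal `abs_devC_le_rhoC_mul_thetaC`: `|Σ^dev_{kl}| ≤ 4 ρ_r θ_r` (`0 < r`). -/
theorem abs_devC_le_rhoC_mul_thetaC :
  ∀ {N : ℕ} {r : ℝ}, 0 < r → ∀ (w : Phase N) (x₀ : T3) (k l : Fin 3), |devC r w x₀ k l| ≤ 4 * (rhoC r w x₀ * thetaC r w x₀) :=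
  fun hr w x₀ k l => psvK_abs_devC_le hr w x₀ k l

end Summit.AtomisticToContinuum.HydrodynamicLimit.Theorems.LocalSecondLawLedger

end
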